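import Summits.BirchSwinnertonDyer.BirchSwinnertonDyer.Theses.KolyvaginRankRigidityAtTwo
import HarnessLib

/-!
# Route KolyvaginRankRigidityAtTwo — the rev-13 deciding chain as a theorem (build repair, proofs only)

Build-fix lane `ops-buildfix-3` (gen 29), `--supports` item stmt-BirchSwinnertonDyer-19218 (nothing here
closes an item).  The route file's deciding theorem `KolyvaginRankRigidityAtTwo.closes` was RE-KEYED at
09:18Z 2026-08-28 (rev 14, "R4-θ") from the margin pair `KolyvaginNonvanishingAtTwoFrameStrong` (V1′ₛ) /
`KolyvaginCorankLowerBoundAtTwoMargin` (V2♭ₘ) to the relative-margin pair `…FrameTheta` / `…Theta`.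
Accepted Theorems files that apply `closes` BY NAME to the rev-13 item list
(`TwoAdicConverseOffHabitatResidualGlue` §(B2)) therefore stopped elaborating.  This file states the rev-13
chain as an ordinary theorem — the rev-14 `closes` VERBATIM with the relative margin `θ` specialised away
(the class of margin `k` that V2♭ₘ asks for is supplied by V1′ₛ, minimality among such classes) — so those
files can be re-glued proof-only with byte-identical statements.

HONEST FRAMING.  Pure logic over the route's OPEN items (V1′ₛ, V2♭ₘ, the residual 24303) and the tree's
named PRINT facts taken as hypotheses; no item is filed or closed; BSD is not proved by any of this.

References: V. A. Kolyvagin, Euler systems (1991) §2 [Kolyvagin1991MathAnn]; B. Gross, D. Zagier,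
Invent. Math. 84 (1986) I (6.1) [GrossZagier1986]; W. Zhang, Camb. J. Math. 2 (2014) [WZhang2014].
-/

set_option autoImplicit false
-- the Theorems namespace of this sub repeats the summit name by design (D-0017 nested layout)
set_option linter.dupNamespace false

namespace Summit.BirchSwinnertonDyer.BirchSwinnertonDyer.Theorems.KolyvaginRankRigidity

open Summit.BirchSwinnertonDyer.BirchSwinnertonDyer.Theses.KolyvaginRankRigidityAtTwo

/-- **KRR2's rev-13 deciding chain (margin pair V1′ₛ / V2♭ₘ)**: the eleven rev-13 items of route
KolyvaginRankRigidityAtTwo imply the registered leaf `Rank1Residual.NonCMTwoConverse` — the rev-14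
`closes` with the relative margin `θ` specialised away (V1′ₛ supplies a non-zero class of the margin `k`
that V2♭ₘ asks for; minimality is taken among such classes).
[cite: Kolyvagin1991MathAnn, §2] [cite: GrossZagier1986, I (6.1)] -/
theorem kolyvaginRankRigidityAtTwo_closes_rev13 (hV1 : KolyvaginNonvanishingAtTwoFrameStrong)
    (hV2 : KolyvaginCorankLowerBoundAtTwoMargin)
    (hR : OffHabitatNonSurjTwoConverse) (hIn : PrintedInputsRankOneAtTwo) (hT : NoTwoTorsionOverK)
    (hf : BFHTwistSupply) (h0 : SimpleZeroTwistSplitAtTwoOfBFH) (hGZK : MultPublishedInputsAtTwo)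
    (hMod : NewformOfEllipticCurve) (hHLT : HoffsteinLuoNonvanishingTwist) (hEnt : EntireLFunctionRat) :
    Summit.BirchSwinnertonDyer.BirchSwinnertonDyer.Rank1Residual.NonCMTwoConverse := by
  have hBFH : SimpleZeroTwistSplitAtTwo := h0 hf
  intro W _ _ hCM hred r hr hc
  by_cases hsur : (∀ m : ℕ, W.HasSurjectiveModNGaloisRep (2 ^ m : ℕ))
  swap
  · exact hR W hCM hred r hr hc hsur
  obtain ⟨-, -, hpar, hKato, -, hGZ, hrec⟩ := hIn
  have hmod : Literature.NumberTheory.EllipticCurves.ModularForms.exists_isNewformOf := hMod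
  have hHL : Literature.NumberTheory.EllipticCurves.HoffsteinLuo1997_exists_twist_L_one_ne_zero := hHLT
  have hE : WeierstrassCurve.hasEntireLFunction_rat := hEnt
  have hGZK' : Literature.NumberTheory.EllipticCurves.rank_eq_analyticRank_of_analyticRank_le_one := hGZK
  haveI : Fact (Nat.Prime 2) := ⟨Nat.prime_two⟩
  haveI : NeZero (W.conductorNorm ℤ) := ⟨(W.conductorNorm_pos_holds).ne'⟩
  obtain rfl | rfl : r = 0 ∨ r = 1 := by omega
  · -- ===== r = 0 : partner twist with a simple zero (BFH 1990 (i), `2` split) =====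
    have hw : W.rootNumber = 1 := by
      have h := hpar W
      unfold Literature.NumberTheory.EllipticCurves.p_parity at h
      rw [hc, pow_zero] at h
      exact h.symm
    obtain ⟨K, _, _, hK, -, hHN, hH2, hd8, hL0, hL1⟩ := hBFH W hw 0
    have hodd : Odd (NumberField.discr K) := by
      rw [Int.odd_iff]; omega
    have hne3 : NumberField.discr K ≠ -3 := by omega
    have hne4 : NumberField.discr K ≠ -4 := by omega
    have h2d : ¬ ((2 : ℤ) ∣ NumberField.discr K) := by omega
    have hd : (NumberField.discr K : ℚ) ≠ 0 := by exact_mod_cast NumberField.discr_ne_zero K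
    haveI := W.isElliptic_quadraticTwist hd
    have hr1 : (W.quadraticTwist (NumberField.discr K : ℚ)).analyticRank = 1 :=
      Literature.NumberTheory.EllipticCurves.analyticRank_eq_one_of_entireLFunction_one_eq_zero_of_deriv_ne_zero
        _ (hE _) hL0 hL1
    obtain ⟨hrk, hsha⟩ := hGZK' (W.quadraticTwist (NumberField.discr K : ℚ)) (le_of_eq hr1)
    rw [hr1] at hrk
    haveI := hsha
    have hc' : (W.quadraticTwist (NumberField.discr K : ℚ)).selmerCorank 2 = 1 :=
      Literature.NumberTheory.EllipticCurves.selmerCorank_eq_one_of_mordellWeilRank_eq_one_of_finite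
        (W.quadraticTwist (NumberField.discr K : ℚ)) 2 hrk inferInstance
    have htor := hT W hsur K hK
    obtain ⟨fW, hfW⟩ := hMod W
    obtain ⟨Dt⟩ :=
      Literature.NumberTheory.Automorphic.nonempty_modularParametrizationData_of_isNewformOf hfW
    obtain ⟨β, hβ⟩ := Literature.NumberTheory.EllipticCurves.exists_dvd_sq_sub_discr_holds (W.conductorNorm ℤ) K hK hHN
    obtain ⟨ι⟩ := (inferInstance : Nonempty (K →+* ℂ))
    obtain ⟨k, hV2k⟩ := hV2 W hCM hred hsur K hK hne3 hne4 h2d hHN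
    obtain ⟨n, d, M, hn, hM1, hMle, hne⟩ := hV1 W hCM hred hsur K hK hHN hodd hne3 htor hH2 Dt β ι hβ k
    -- a non-zero class of margin `k` of MINIMAL depth among such classes (well-ordering of ℕ; inlined
    -- margin variant of `heegnerSystem_exists_minimal_kolyvaginClass_ne_zero`)
    obtain ⟨n₀, d₀, M₀, hn₀, hM₀, hM₀le, hne₀, hmin⟩ :
        ∃ (n₀ : ℕ) (d₀ : Literature.NumberTheory.EllipticCurves.KolyvaginHeegnerData Dt β ι n₀) (M₀ : ℕ),
          Literature.NumberTheory.EllipticCurves.KolyvaginDescent.KolSupp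
            (Literature.NumberTheory.EllipticCurves.Zhang2014.IsKolyvaginPrime (W.conductorNorm ℤ) W K 2) n₀ ∧
          1 ≤ M₀ ∧ ((M₀ + k : ℕ) : ℕ∞) ≤ Literature.NumberTheory.EllipticCurves.Zhang2014.levelIndex W 2 n₀ ∧
          d₀.kolyvaginClass Nat.prime_two M₀ ≠ 0 ∧
          ∀ (n' : ℕ) (d' : Literature.NumberTheory.EllipticCurves.KolyvaginHeegnerData Dt β ι n') (M' : ℕ),
            Literature.NumberTheory.EllipticCurves.KolyvaginDescent.KolSupp
              (Literature.NumberTheory.EllipticCurves.Zhang2014.IsKolyvaginPrime (W.conductorNorm ℤ) W K 2) n' →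
            1 ≤ M' → ((M' + k : ℕ) : ℕ∞) ≤ Literature.NumberTheory.EllipticCurves.Zhang2014.levelIndex W 2 n' →
            d'.kolyvaginClass Nat.prime_two M' ≠ 0 → n₀.primeFactors.card ≤ n'.primeFactors.card := by
      classical
      let P : ℕ → Prop := fun c ↦ ∃ (n' : ℕ)
        (d' : Literature.NumberTheory.EllipticCurves.KolyvaginHeegnerData Dt β ι n') (M' : ℕ),
        Literature.NumberTheory.EllipticCurves.KolyvaginDescent.KolSupp
          (Literature.NumberTheory.EllipticCurves.Zhang2014.IsKolyvaginPrime (W.conductorNorm ℤ) W K 2) n' ∧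
          1 ≤ M' ∧ ((M' + k : ℕ) : ℕ∞) ≤ Literature.NumberTheory.EllipticCurves.Zhang2014.levelIndex W 2 n' ∧
          d'.kolyvaginClass Nat.prime_two M' ≠ 0 ∧ n'.primeFactors.card = c
      have hex : ∃ c, P c := ⟨_, n, d, M, hn, hM1, hMle, hne, rfl⟩
      obtain ⟨n₁, d₁, M₁, hn₁, hM₁, hM₁le, hne₁, hk₁⟩ := Nat.find_spec hex
      refine ⟨n₁, d₁, M₁, hn₁, hM₁, hM₁le, hne₁, fun n' d' M' hn' hM' hM'le hne' ↦ ?_⟩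
      rw [hk₁]
      exact Nat.find_min' hex ⟨n', d', M', hn', hM', hM'le, hne', rfl⟩
    -- the ONLY use of V2 (weakened): the lower bound `ν + 1 ≤ max(c, c') = 1` forces `ν = 0`
    have hstruct := hV2k Dt β ι n₀ d₀ M₀ hn₀ hM₀ hM₀le hne₀ hmin
    have hν : n₀.primeFactors.card = 0 := by
      rcases hstruct with h1 | h1 <;> omega
    have hn1 : n₀ = 1 := by
      rw [Finset.card_eq_zero, Nat.primeFactors_eq_empty] at hν
      rcases hν with h0 | h1
      · exact absurd (h0 ▸ hn₀.1) not_squarefree_zero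
      · exact h1
    subst hn1
    have hEK : Literature.NumberTheory.EllipticCurves.analyticRankEK W K = 1 :=
      Literature.NumberTheory.EllipticCurves.heegnerSystem_analyticRankEK_eq_one_of_kolyvaginClass_one_ne_zero
        (hGZ W _ K) (hrec _ W K) hK rfl hHN d₀ hne₀
    rw [Literature.NumberTheory.EllipticCurves.analyticRankEK_eq_add_of hE W K, hr1] at hEK
    omega
  · -- ===== r = 1 : partner twist with L(E^{(d_K)}, 1) ≠ 0 (Hoffstein–Luo) =====
    have hw : W.rootNumber = -1 := by
      have h := hpar W
      unfold Literature.NumberTheory.EllipticCurves.p_parity at h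
      rw [hc, pow_one] at h
      exact h.symm
    obtain ⟨K, _, _, hK, -, hHN, hH2, hd8, hL1⟩ :=
      Literature.NumberTheory.EllipticCurves.exists_heegnerField_split_twist_ne_zero_discr_emod_eight_of_hoffsteinLuo
        hmod hHL W hw Nat.prime_two 0
    have hodd : Odd (NumberField.discr K) := by
      rw [Int.odd_iff]; omega
    have hne3 : NumberField.discr K ≠ -3 := by omega
    have hne4 : NumberField.discr K ≠ -4 := by omega
    have h2d : ¬ ((2 : ℤ) ∣ NumberField.discr K) := by omega
    have hd : (NumberField.discr K : ℚ) ≠ 0 := by exact_mod_cast NumberField.discr_ne_zero K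
    haveI := W.isElliptic_quadraticTwist hd
    obtain ⟨-, -, hfin⟩ := hKato (W.quadraticTwist (NumberField.discr K : ℚ)) hL1
    haveI := hfin
    have hc' : (W.quadraticTwist (NumberField.discr K : ℚ)).selmerCorank 2 = 0 :=
      (W.quadraticTwist (NumberField.discr K : ℚ)).selmerCorank_eq_zero_of_finite 2
    have htor := hT W hsur K hK
    obtain ⟨fW, hfW⟩ := hMod W
    obtain ⟨Dt⟩ :=
      Literature.NumberTheory.Automorphic.nonempty_modularParametrizationData_of_isNewformOf hfW
    obtain ⟨β, hβ⟩ := Literature.NumberTheory.EllipticCurves.exists_dvd_sq_sub_discr_holds (W.conductorNorm ℤ) K hK hHN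
    obtain ⟨ι⟩ := (inferInstance : Nonempty (K →+* ℂ))
    obtain ⟨k, hV2k⟩ := hV2 W hCM hred hsur K hK hne3 hne4 h2d hHN
    obtain ⟨n, d, M, hn, hM1, hMle, hne⟩ := hV1 W hCM hred hsur K hK hHN hodd hne3 htor hH2 Dt β ι hβ k
    -- a non-zero class of margin `k` of MINIMAL depth among such classes (well-ordering of ℕ; inlined
    -- margin variant of `heegnerSystem_exists_minimal_kolyvaginClass_ne_zero`)
    obtain ⟨n₀, d₀, M₀, hn₀, hM₀, hM₀le, hne₀, hmin⟩ :
        ∃ (n₀ : ℕ) (d₀ : Literature.NumberTheory.EllipticCurves.KolyvaginHeegnerData Dt β ι n₀) (M₀ : ℕ),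
          Literature.NumberTheory.EllipticCurves.KolyvaginDescent.KolSupp
            (Literature.NumberTheory.EllipticCurves.Zhang2014.IsKolyvaginPrime (W.conductorNorm ℤ) W K 2) n₀ ∧
          1 ≤ M₀ ∧ ((M₀ + k : ℕ) : ℕ∞) ≤ Literature.NumberTheory.EllipticCurves.Zhang2014.levelIndex W 2 n₀ ∧
          d₀.kolyvaginClass Nat.prime_two M₀ ≠ 0 ∧
          ∀ (n' : ℕ) (d' : Literature.NumberTheory.EllipticCurves.KolyvaginHeegnerData Dt β ι n') (M' : ℕ),
            Literature.NumberTheory.EllipticCurves.KolyvaginDescent.KolSupp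
              (Literature.NumberTheory.EllipticCurves.Zhang2014.IsKolyvaginPrime (W.conductorNorm ℤ) W K 2) n' →
            1 ≤ M' → ((M' + k : ℕ) : ℕ∞) ≤ Literature.NumberTheory.EllipticCurves.Zhang2014.levelIndex W 2 n' →
            d'.kolyvaginClass Nat.prime_two M' ≠ 0 → n₀.primeFactors.card ≤ n'.primeFactors.card := by
      classical
      let P : ℕ → Prop := fun c ↦ ∃ (n' : ℕ)
        (d' : Literature.NumberTheory.EllipticCurves.KolyvaginHeegnerData Dt β ι n') (M' : ℕ),
        Literature.NumberTheory.EllipticCurves.KolyvaginDescent.KolSupp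
          (Literature.NumberTheory.EllipticCurves.Zhang2014.IsKolyvaginPrime (W.conductorNorm ℤ) W K 2) n' ∧
          1 ≤ M' ∧ ((M' + k : ℕ) : ℕ∞) ≤ Literature.NumberTheory.EllipticCurves.Zhang2014.levelIndex W 2 n' ∧
          d'.kolyvaginClass Nat.prime_two M' ≠ 0 ∧ n'.primeFactors.card = c
      have hex : ∃ c, P c := ⟨_, n, d, M, hn, hM1, hMle, hne, rfl⟩
      obtain ⟨n₁, d₁, M₁, hn₁, hM₁, hM₁le, hne₁, hk₁⟩ := Nat.find_spec hex
      refine ⟨n₁, d₁, M₁, hn₁, hM₁, hM₁le, hne₁, fun n' d' M' hn' hM' hM'le hne' ↦ ?_⟩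
      rw [hk₁]
      exact Nat.find_min' hex ⟨n', d', M', hn', hM', hM'le, hne', rfl⟩
    -- the ONLY use of V2 (weakened): the lower bound `ν + 1 ≤ max(c, c') = 1` forces `ν = 0`
    have hstruct := hV2k Dt β ι n₀ d₀ M₀ hn₀ hM₀ hM₀le hne₀ hmin
    have hν : n₀.primeFactors.card = 0 := by
      rcases hstruct with h1 | h1 <;> omega
    have hn1 : n₀ = 1 := by
      rw [Finset.card_eq_zero, Nat.primeFactors_eq_empty] at hν
      rcases hν with h0 | h1
      · exact absurd (h0 ▸ hn₀.1) not_squarefree_zero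
      · exact h1
    subst hn1
    have hEK : Literature.NumberTheory.EllipticCurves.analyticRankEK W K = 1 :=
      Literature.NumberTheory.EllipticCurves.heegnerSystem_analyticRankEK_eq_one_of_kolyvaginClass_one_ne_zero
        (hGZ W _ K) (hrec _ W K) hK rfl hHN d₀ hne₀
    rw [Literature.NumberTheory.EllipticCurves.analyticRankEK_eq_add_of hE W K,
      Literature.NumberTheory.EllipticCurves.analyticRank_eq_zero_of_entireLFunction_one_ne_zero _ hL1,
      add_zero] at hEK
    exact hEK

end Summit.BirchSwinnertonDyer.BirchSwinnertonDyer.Theorems.KolyvaginRankRigidity
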